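import Literature.Analysis.FluidPDE.FluidComputer.ThresholdLevelTableV
import HarnessLib

/-!
# Kernel run of the level-table checker over the box `V`, chunks 12 … 15 (bp3 gen 13, layer 4: robustness variant V)

HONEST FRAMING: low prior, high value-of-information experiment on Tao's machine paradigm; NOT a
claim that NS blows up.

Four kernel evaluations (`decide +kernel`; no `native_decide`, no extra axioms) of `runSteps`
with the interval gate data `GIv` (`ε, σ, r` within relative `3·10⁻²`, `δ ∈ [0, δ₀]`),
25 steps each, from `Bv12` to `Bv16`.
-/

namespace Literature.Analysis.FluidPDE.FluidComputer

namespace ThresholdLevelTable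

set_option maxHeartbeats 10000000 in
set_option maxRecDepth 200000 in
/-- Chunk 12 of the box-`V` table run (steps 300 … 324). [folklore] -/
theorem runV12 : runSteps 60 12 3 GIv RbIt Bv12 chunk12 4525524321594313 = some Bv13 := by
  decide +kernel

set_option maxHeartbeats 10000000 in
set_option maxRecDepth 200000 in
/-- Chunk 13 of the box-`V` table run (steps 325 … 349). [folklore] -/
theorem runV13 : runSteps 60 12 3 GIv RbIt Bv13 chunk13 5386115000203920 = some Bv14 := by
  decide +kernel

set_option maxHeartbeats 10000000 in
set_option maxRecDepth 200000 in
/-- Chunk 14 of the box-`V` table run (steps 350 … 374). [folklore] -/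
theorem runV14 : runSteps 60 12 3 GIv RbIt Bv14 chunk14 6410358830024270 = some Bv15 := by
  decide +kernel

set_option maxHeartbeats 10000000 in
set_option maxRecDepth 200000 in
/-- Chunk 15 of the box-`V` table run (steps 375 … 399). [folklore] -/
theorem runV15 : runSteps 60 12 3 GIv RbIt Bv15 chunk15 7629376708093743 = some Bv16 := by
  decide +kernel

end ThresholdLevelTable

end Literature.Analysis.FluidPDE.FluidComputer
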